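import Summits.QuantumFields.BalabanUV.Beta.GAN24.TaylorLamBracket
import Summits.QuantumFields.BalabanUV.Beta.SpineRootedSc

/-!
# `BalabanUV.Beta.GAN24.TaylorLamBracketAt` — binder row G-an2-4 / (CONV-C), road S3 AT THE IN-BLOCK ROOT: package (ρ-b) of the row owner gan24-p1-g21's WANTED
# «ROOTED-S3-Λ» ([GAN24P1-G21-ONLINE] (W5)) — **THE TWO STATEMENTS OF `TaylorLamBracket` THAT NAME `hessFF` ∕ `lagrInc`, RE-RUN FOR an1's ROOTED TABLE
# `hessFFAt (toSite r) Lc` AND THE ROOTED INCREMENT `SpineRooted.lagrIncAt d (toSite r) Lc`** (box root `r ∈ box (d+1) Lc`): the lifted rooted constraint Hessians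
# are entrywise `≤ 2·ℓ(Lc)²` (an1's `biLoc_hessFFAt`), and the TOP Λ ROW's vertex insertion of `lagrIncAt` is the level-`N` multiplier kernel against them

NOT IN PRINT; OUR BOOKKEEPING (G-an2-4 formalisation swarm → CRUX TEAM (2), leaf prover `b2b-balaban-gan24-formalise-leaf-01`, gen 60; «MINE (ρ-b)» journal `CLAIMS.log`
l.34234; METHOD = the owner's gen-6 `mkroot.py` rule: same theorem names in the `…At` namespace, `hessFF Lc ↦ hessFFAt (toSite r) Lc`, `lagrInc d Lc ↦ lagrIncAt d (toSite r) Lc`,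
an1's `biLoc_hessFFAt` (box root: one extra binder `(hr : r ∈ box (d+1) Lc)`), every root-free lemma of the base module (`vertex_SLam_top`, `DecLiftAdjoint.abs_avgLift_le`)
BY NAME; base module untouched).  [folklore]; 0 `def`, 0 cited facts, 0 `def … : Prop`, 0 sorry; NO estimate of Bałaban's.  HONEST FRAMING (cell contract, verbatim):
«discharging `BetaPertH` makes Bałaban's UV stability UNCONDITIONAL — a real constructive-QFT result; it is NOT the continuum limit and NOT the Clay problem.»  HONEST
DEPENDENCY (verbatim): «continuum YM on T⁴ ⇐ BetaPertH ∧ nine spine estimates (0/9 proved); BetaPertH ⇐ (D1) ∧ (D4) ∧ CAP+tail; G-an2-4 gates asym, D1 and NE2/3/4.»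

## What (generic `d`; box root `ρ = toSite r`, `r ∈ box (d+1) Lc`, `1 ≤ Lc`; every `M ≥ 1`, `N ≥ 1`)
* **`abs_avgLift_hessFFAt_le`**: `|avgLift M (hessFFAt (toSite r) Lc μ yy) w y a b| ≤ 2·ℓ(Lc)²` (uniform in the bond, the blocking and the arguments — an1's rooted `biLoc_hessFFAt`
  at rate `0` has the SAME constant as `biLoc_hessFF`).
* **`vertex_lagrIncAt_top`**: `Σ_{κ″} Σ'_u wH_N κ″ κ′ (u − N•u′) · lagrIncAt d (toSite r) Lc M N κ″ u w y a b = Σ_μ Σ'_yy wΦ_N κ′ μ (u′ − yy) · avgLift M (hessFFAt (toSite r) Lc μ yy) w y a b`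
  (the base `vertex_SLam_top` BY NAME with the rooted `Q2`).
* bridge `vertex_lagrIncAt_top_zero_root`: at `r = 0` this is `vertex_lagrInc_top` (`lagrIncAt_zero`, `hessFFAt_zero`, `toSite 0 = 0`).
USE: (ρ-d) `TaylorRowLamTopAt` consumes `vertex_lagrIncAt_top` where the base row used `vertex_lagrInc_top`.  Discharges NOTHING of (hS, hSall); NEVER «G-an2-4 closed»;
NOT D1, NOT BetaPertH, NOT continuum, NOT Clay.
-/

noncomputable section

open Finset
open scoped BigOperators
open Literature.MathematicalPhysics.QuantumFieldTheory
open Literature.MathematicalPhysics.QuantumFieldTheory.Balaban1983to89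
open Literature.MathematicalPhysics.QuantumFieldTheory.Balaban1983to89.Beta
open AffineAveraging (Site box toSite)
open OneStepResolventKernel (Fib KInv)
open KernelSpecInstance (wH wΦ)
open BalabanStepJets (lamCoeffOf)
open InterLevelTransport (SLam avgLift)
open BalabanCompositeJets (lagrInc)
open AveragingHessianKernels (hessFF ell)
open AveragingHessianKernelsRooted (hessFFAt biLoc_hessFFAt hessFFAt_zero)
open DecLiftAdjoint (abs_avgLift_le)
open Summit.QuantumFields.BalabanUV.Beta.SpineRooted (lagrIncAt lagrIncAt_zero)
open Summit.QuantumFields.BalabanUV.Beta.GAN24.TaylorLamBracket (vertex_SLam_top vertex_lagrInc_top)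

namespace Summit.QuantumFields.BalabanUV.Beta.GAN24.TaylorLamBracketAt

variable {d : ℕ} {N : ℕ} [NeZero N]

/-- [folklore] an1's ROOTED one-step constraint Hessians (box root), lifted to the fine field legs, are entrywise bounded by `2·ℓ(Lc)²` (uniformly in the coarse bond,
the blocking `M`, the root offset in the box and the arguments): `biLoc_hessFFAt` at rate `0` and `DecLiftAdjoint.abs_avgLift_le`. -/
theorem abs_avgLift_hessFFAt_le {Lc : ℕ} (M : ℕ) [NeZero M] (hLc : 1 ≤ Lc) {r : Fin (d + 1) → ℕ} (hr : r ∈ box (d + 1) Lc)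
    (μ : Fin (d + 1)) (yy w y : Site (d + 1)) (a b : Fib d) :
    |avgLift M (hessFFAt (toSite r) (d := d) Lc μ yy) w y a b| ≤ 2 * (ell (d + 1) Lc : ℝ) ^ 2 := by
  refine abs_avgLift_le M (fun x w' a' b' => ?_) w y a b
  simpa using biLoc_hessFFAt (d := d) hLc μ yy hr le_rfl x w' a' b'

/-- [folklore] **TOP Λ ROW, ROOTED: THE VERTEX INSERTION OF THE ROOTED LAGRANGE INCREMENT** (box root; every `M`, `N ≥ 1`, `Lc ≥ 1`) —
`Σ_{κ″} Σ'_u wH_N κ″ κ′ (u − N•u′) · lagrIncAt d (toSite r) Lc M N κ″ u w y a b = Σ_μ Σ'_yy wΦ_N κ′ μ (u′ − yy) · avgLift M (hessFFAt (toSite r) Lc μ yy) w y a b`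
(the base `vertex_SLam_top` with the rooted, entrywise-bounded `Q2`). -/
theorem vertex_lagrIncAt_top {Lc : ℕ} (M : ℕ) [NeZero M] (hLc : 1 ≤ Lc) {r : Fin (d + 1) → ℕ} (hr : r ∈ box (d + 1) Lc)
    (κ' : Fin (d + 1)) (u' w y : Site (d + 1)) (a b : Fib d) :
    ∑ κ'', ∑' u, wH (N := N) κ'' κ' (u - (N : ℤ) • u') * lagrIncAt d (toSite r) Lc M N κ'' u w y a b =
      ∑ μ, ∑' yy, wΦ (N := N) κ' μ (u' - yy) * avgLift M (hessFFAt (toSite r) (d := d) Lc μ yy) w y a b :=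
  vertex_SLam_top (N := N) (fun μ yy => avgLift M (hessFFAt (toSite r) (d := d) Lc μ yy))
    (fun μ yy w y a b => abs_avgLift_hessFFAt_le M hLc hr μ yy w y a b) κ' u' w y a b

/-- [folklore] BRIDGE: at the corner root `r = 0` (`toSite 0 = 0`, `hessFFAt_zero`, `lagrIncAt_zero`) the rooted vertex insertion IS the base `vertex_lagrInc_top`
— both sides agree with the base statement's. -/
theorem vertex_lagrIncAt_top_zero_root {Lc : ℕ} (M : ℕ) [NeZero M] (hLc : 1 ≤ Lc) (κ' : Fin (d + 1)) (u' w y : Site (d + 1)) (a b : Fib d) :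
    ∑ κ'', ∑' u, wH (N := N) κ'' κ' (u - (N : ℤ) • u') * lagrIncAt d 0 Lc M N κ'' u w y a b =
      ∑ μ, ∑' yy, wΦ (N := N) κ' μ (u' - yy) * avgLift M (hessFF (d := d) Lc μ yy) w y a b := by
  rw [lagrIncAt_zero]
  exact vertex_lagrInc_top M hLc κ' u' w y a b

end Summit.QuantumFields.BalabanUV.Beta.GAN24.TaylorLamBracketAt

end
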